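import Summits.CriticalPhenomena.Ising3D.ExclusionSentences

/-!
# Exclusion sentences — family ALG, kernel machine (cell `pub-ising3x`, seat recog-1)

HONEST FRAMING: lottery ticket; floor = tightest certified 3D Ising CFT bounds; no exact-solution
claim without a proof.

The integer-only checker behind the ALG exclusion sentence of `ExclusionSentencesAlg.lean` (family
`ALG` of the frozen list `HOME/frozen/FAMILIES-v1.json`: real algebraic numbers given by an integer
polynomial of degree `d ≤ 6` and height `≤ H_d`), with its soundness lemmas:

* `evalL c x = Σ cᵢ xⁱ` for a coefficient list `c = [c₀, c₁, …]` (`evalL_ofFn`);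
* `encloseZ LO HI M c = (U, V, N)` — interval-Horner enclosure in scaled integers:
  `U ≤ evalL c x · N ≤ V` for `x · M ∈ [LO, HI] ⊂ [0, ∞)` (`encloseZ_sound`); `signTest`, and `exclTest`
  = sign test with bisection (`exclTest_sound`: no root in the interval);
* `polyAdd`, `polyMul` (`evalL_polyMul`), the division heuristic `polyQuot` (never trusted: every use is
  verified by re-multiplication) and `rootCovered` — a candidate is discharged by `exclTest` or by exact
  deflation `c = q · g` against a listed polynomial `q`, recursively (`rootCovered_sound`: every root of
  `c` in the interval is a root of a listed polynomial);
* the search `coeffLoop` / `leafCheck` / `algCore`: leading coefficient `a_d ∈ [1, H]`, middle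
  coefficients in `[−H, H]`, constant coefficient SOLVED from the enclosure of `x (a₁ + a₂ x + ⋯)`
  (`algCore_sound`).

Design as in `ExclusionSentences.lean`: `Bool` checkers over integers and lists, evaluated by one
`decide +kernel`, plus soundness theorems; no `native_decide`, no new axioms. Nothing here mentions the
3D Ising model; no certificate and no digit is used.
-/

namespace Summit.CriticalPhenomena.Ising3D

/-! ### Integer polynomials as coefficient lists `[a₀, a₁, …, a_d]` -/

/-- Horner evaluation of an integer coefficient list at a real point:
`evalL [a₀, a₁, …, a_d] x = a₀ + x (a₁ + x (⋯)) = Σ aᵢ xⁱ` (`evalL_ofFn`). -/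
noncomputable def evalL : List ℤ → ℝ → ℝ
  | [], _ => 0
  | a :: cs, x => (a : ℝ) + x * evalL cs x

/-- `evalL [] x = 0`. -/
@[simp] theorem evalL_nil (x : ℝ) : evalL [] x = 0 := rfl

/-- `evalL (a :: cs) x = a + x · evalL cs x`. -/
@[simp] theorem evalL_cons (a : ℤ) (cs : List ℤ) (x : ℝ) :
    evalL (a :: cs) x = a + x * evalL cs x := rfl

/-- `evalL` is the polynomial function `Σ cᵢ xⁱ` of the coefficient vector. -/
theorem evalL_ofFn (x : ℝ) : ∀ {n : ℕ} (c : Fin n → ℤ),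
    evalL (List.ofFn c) x = ∑ i, (c i : ℝ) * x ^ (i : ℕ)
  | 0, c => by simp
  | n + 1, c => by
      rw [List.ofFn_succ, evalL_cons, evalL_ofFn, Fin.sum_univ_succ, Finset.mul_sum]
      simp only [Fin.val_zero, pow_zero, mul_one, Fin.val_succ, pow_succ]
      congr 1
      exact Finset.sum_congr rfl fun i _ => by ring

/-! ### Interval-Horner enclosure in scaled integers -/

/-- One scaled Horner step: from `(U, V, N)` enclosing the inner value to the enclosure of
`a + x · (inner)` at scale `M · N`, for `x · M ∈ [LO, HI]`. -/
def encStep (LO HI M a : ℤ) (e : ℤ × ℤ × ℤ) : ℤ × ℤ × ℤ :=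
  (a * (M * e.2.2) + min (LO * e.1) (HI * e.1), a * (M * e.2.2) + max (LO * e.2.1) (HI * e.2.1),
    M * e.2.2)

/-- `encloseZ LO HI M c = (U, V, N)`: `N = M ^ c.length` and `U ≤ evalL c x · N ≤ V` whenever
`LO ≤ x · M ≤ HI` (for `0 ≤ LO`, `0 < M`; `encloseZ_sound`). Integer arithmetic only. -/
def encloseZ (LO HI M : ℤ) : List ℤ → ℤ × ℤ × ℤ
  | [] => (0, 0, 1)
  | a :: cs => encStep LO HI M a (encloseZ LO HI M cs)

/-- The product bound behind one Horner step: `y ∈ [LO, HI]` with `0 ≤ LO` and `t ∈ [U, V]` give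
`min (LO U) (HI U) ≤ y t ≤ max (LO V) (HI V)`. -/
theorem mul_mem_bounds {LO HI U V : ℤ} {y t : ℝ} (hLO : 0 ≤ LO) (hy1 : (LO : ℝ) ≤ y)
    (hy2 : y ≤ HI) (ht1 : (U : ℝ) ≤ t) (ht2 : t ≤ V) :
    ((min (LO * U) (HI * U) : ℤ) : ℝ) ≤ y * t ∧ y * t ≤ ((max (LO * V) (HI * V) : ℤ) : ℝ) := by
  have hy0 : 0 ≤ y := le_trans (by exact_mod_cast hLO) hy1
  push_cast
  constructor
  · rcases le_or_gt 0 (U : ℝ) with hU | hU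
    · calc min ((LO : ℝ) * U) (HI * U) ≤ (LO : ℝ) * U := min_le_left _ _
        _ ≤ y * U := mul_le_mul_of_nonneg_right hy1 hU
        _ ≤ y * t := mul_le_mul_of_nonneg_left ht1 hy0
    · calc min ((LO : ℝ) * U) (HI * U) ≤ (HI : ℝ) * U := min_le_right _ _
        _ ≤ y * U := mul_le_mul_of_nonpos_right hy2 hU.le
        _ ≤ y * t := mul_le_mul_of_nonneg_left ht1 hy0
  · rcases le_or_gt 0 (V : ℝ) with hV | hV
    · calc y * t ≤ y * V := mul_le_mul_of_nonneg_left ht2 hy0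
        _ ≤ HI * V := mul_le_mul_of_nonneg_right hy2 hV
        _ ≤ max ((LO : ℝ) * V) (HI * V) := le_max_right _ _
    · calc y * t ≤ y * V := mul_le_mul_of_nonneg_left ht2 hy0
        _ ≤ LO * V := mul_le_mul_of_nonpos_right hy1 hV.le
        _ ≤ max ((LO : ℝ) * V) (HI * V) := le_max_left _ _

/-- **Soundness of the enclosure.** -/
theorem encloseZ_sound {LO HI M : ℤ} (hLO : 0 ≤ LO) (hM : 0 < M) {x : ℝ} (hlo : (LO : ℝ) ≤ x * M)
    (hhi : x * M ≤ HI) : ∀ c : List ℤ,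
    ((encloseZ LO HI M c).1 : ℝ) ≤ evalL c x * (encloseZ LO HI M c).2.2 ∧
      evalL c x * (encloseZ LO HI M c).2.2 ≤ ((encloseZ LO HI M c).2.1 : ℝ) ∧
      0 < (encloseZ LO HI M c).2.2
  | [] => by simp [encloseZ]
  | a :: cs => by
      obtain ⟨h1, h2, hN⟩ := encloseZ_sound hLO hM hlo hhi cs
      have hb := mul_mem_bounds hLO hlo hhi h1 h2
      refine ⟨?_, ?_, ?_⟩
      · simp only [encloseZ, encStep, evalL_cons]
        have e : ((a : ℝ) + x * evalL cs x) * ((M * (encloseZ LO HI M cs).2.2 : ℤ) : ℝ) =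
            (a : ℝ) * ((M * (encloseZ LO HI M cs).2.2 : ℤ) : ℝ) +
              x * M * (evalL cs x * (encloseZ LO HI M cs).2.2) := by push_cast; ring
        rw [e]; push_cast at hb ⊢; linarith [hb.1]
      · simp only [encloseZ, encStep, evalL_cons]
        have e : ((a : ℝ) + x * evalL cs x) * ((M * (encloseZ LO HI M cs).2.2 : ℤ) : ℝ) =
            (a : ℝ) * ((M * (encloseZ LO HI M cs).2.2 : ℤ) : ℝ) +
              x * M * (evalL cs x * (encloseZ LO HI M cs).2.2) := by push_cast; ring
        rw [e]; push_cast at hb ⊢; linarith [hb.2]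
      · simp only [encloseZ, encStep]; exact mul_pos hM hN

/-- The enclosure of `c` on `[LO/M, HI/M]` excludes `0`. -/
def signTest (c : List ℤ) (LO HI M : ℤ) : Bool :=
  decide (0 < (encloseZ LO HI M c).1) || decide ((encloseZ LO HI M c).2.1 < 0)

/-- Soundness of the sign test: no root with `x · M ∈ [LO, HI]`. -/
theorem signTest_sound {c : List ℤ} {LO HI M : ℤ} (h : signTest c LO HI M = true) (hLO : 0 ≤ LO)
    (hM : 0 < M) {x : ℝ} (hlo : (LO : ℝ) ≤ x * M) (hhi : x * M ≤ HI) : evalL c x ≠ 0 := by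
  obtain ⟨h1, h2, hN⟩ := encloseZ_sound hLO hM hlo hhi c
  have hN' : (0 : ℝ) < (encloseZ LO HI M c).2.2 := by exact_mod_cast hN
  simp only [signTest, Bool.or_eq_true, decide_eq_true_eq] at h
  intro h0
  rw [h0, zero_mul] at h1 h2
  rcases h with h | h
  · have : (0 : ℝ) < (encloseZ LO HI M c).1 := by exact_mod_cast h
    linarith
  · have : ((encloseZ LO HI M c).2.1 : ℝ) < 0 := by exact_mod_cast h
    linarith

/-- Sign test with bisection to depth `n` (each half rescaled by `2`, still integers). -/
def exclTest (c : List ℤ) : ℕ → ℤ → ℤ → ℤ → Bool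
  | 0, LO, HI, M => signTest c LO HI M
  | n + 1, LO, HI, M => signTest c LO HI M ||
      (exclTest c n (2 * LO) (LO + HI) (2 * M) && exclTest c n (LO + HI) (2 * HI) (2 * M))

/-- Soundness of the bisection test: `exclTest c n LO HI M = true` ⇒ `c` has no root `x` with
`x · M ∈ [LO, HI]`. -/
theorem exclTest_sound (c : List ℤ) : ∀ (n : ℕ) {LO HI M : ℤ}, exclTest c n LO HI M = true →
    0 ≤ LO → 0 < M → ∀ {x : ℝ}, (LO : ℝ) ≤ x * M → x * M ≤ HI → evalL c x ≠ 0
  | 0, _, _, _, h, hLO, hM, _, hlo, hhi => signTest_sound h hLO hM hlo hhi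
  | n + 1, LO, HI, M, h, hLO, hM, x, hlo, hhi => by
      simp only [exclTest, Bool.or_eq_true, Bool.and_eq_true] at h
      rcases h with h | ⟨h1, h2⟩
      · exact signTest_sound h hLO hM hlo hhi
      · have hLH : (LO : ℝ) ≤ HI := le_trans hlo hhi
        rcases le_total (x * ((2 * M : ℤ) : ℝ)) ((LO + HI : ℤ) : ℝ) with hle | hge
        · exact exclTest_sound c n h1 (by linarith) (by linarith) (x := x)
            (by push_cast; linarith) hle
        · exact exclTest_sound c n h2 (by exact_mod_cast (show (0 : ℝ) ≤ LO + HI by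
            have : (0 : ℝ) ≤ LO := by exact_mod_cast hLO
            linarith)) (by linarith) (x := x) hge (by push_cast; linarith)

/-! ### Exact deflation by listed polynomials -/

/-- Coefficientwise sum of two coefficient lists. -/
def polyAdd : List ℤ → List ℤ → List ℤ
  | [], q => q
  | a :: p, [] => a :: p
  | a :: p, b :: q => (a + b) :: polyAdd p q

/-- Product of two coefficient lists. -/
def polyMul : List ℤ → List ℤ → List ℤ
  | [], _ => []
  | a :: p, q => polyAdd (q.map (a * ·)) (0 :: polyMul p q)

/-- `evalL` is additive under `polyAdd`. -/
theorem evalL_polyAdd (x : ℝ) : ∀ p q : List ℤ, evalL (polyAdd p q) x = evalL p x + evalL q x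
  | [], q => by simp [polyAdd]
  | a :: p, [] => by simp [polyAdd]
  | a :: p, b :: q => by rw [polyAdd, evalL_cons, evalL_cons, evalL_cons, evalL_polyAdd x p q]; push_cast; ring

/-- `evalL` of a scalar multiple. -/
theorem evalL_map_mul (x : ℝ) (k : ℤ) : ∀ q : List ℤ, evalL (q.map (k * ·)) x = k * evalL q x
  | [] => by simp
  | b :: q => by rw [List.map_cons, evalL_cons, evalL_cons, evalL_map_mul x k q]; push_cast; ring

/-- `evalL` is multiplicative under `polyMul`. -/
theorem evalL_polyMul (x : ℝ) : ∀ p q : List ℤ, evalL (polyMul p q) x = evalL p x * evalL q x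
  | [], q => by simp [polyMul]
  | a :: p, q => by
      rw [polyMul, evalL_polyAdd, evalL_map_mul, evalL_cons, evalL_cons, evalL_polyMul x p q]
      push_cast; ring

/-- `v − u` aligned at the head (`u` no longer than `v`); a helper of the division heuristic. -/
def subHead : List ℤ → List ℤ → List ℤ
  | [], v => v
  | _ :: _, [] => []
  | a :: u, b :: v => (b - a) :: subHead u v

/-- Long division on leading-first coefficient lists producing `k` quotient coefficients; exact when
the divisor divides, unspecified otherwise (every use is verified by re-multiplication). -/
def divRev (Q : List ℤ) : ℕ → List ℤ → List ℤ
  | 0, _ => []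
  | k + 1, C =>
    match Q, C with
    | qm :: Q', cn :: C' =>
        (cn / qm) :: divRev Q k (subHead (Q'.map ((cn / qm) * ·)) C')
    | _, _ => []

/-- Candidate quotient `c / q` of low-order-first coefficient lists (unverified). -/
def polyQuot (c q : List ℤ) : List ℤ :=
  (divRev q.reverse (c.length + 1 - q.length) c.reverse).reverse

/-- `rootCovered depth ex LO HI M fuel c = true` certifies: every root `x` of `c` with
`x · M ∈ [LO, HI]` is a root of a polynomial of the list `ex` — either the plain sign test shows `c` has no
such root, or `c = q · g` exactly for a listed `q` (verified by multiplication) and `g` is covered in turn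
(`fuel` deflation steps), or the bisection sign test excludes a root (tried last: it is the costly one). -/
def rootCovered (depth : ℕ) (ex : List (List ℤ)) (LO HI M : ℤ) : ℕ → List ℤ → Bool
  | 0, c => exclTest c depth LO HI M
  | fuel + 1, c => signTest c LO HI M ||
      (ex.any fun q => (polyMul q (polyQuot c q) == c) && rootCovered depth ex LO HI M fuel (polyQuot c q)) ||
      exclTest c depth LO HI M

/-- **Soundness of `rootCovered`.** -/
theorem rootCovered_sound {depth : ℕ} {ex : List (List ℤ)} {LO HI M : ℤ} (hLO : 0 ≤ LO)
    (hM : 0 < M) {x : ℝ} (hlo : (LO : ℝ) ≤ x * M) (hhi : x * M ≤ HI) :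
    ∀ (fuel : ℕ) (c : List ℤ), rootCovered depth ex LO HI M fuel c = true → evalL c x = 0 →
      ∃ q ∈ ex, evalL q x = 0
  | 0, c, h, hc => absurd hc (exclTest_sound c depth h hLO hM hlo hhi)
  | fuel + 1, c, h, hc => by
      simp only [rootCovered, Bool.or_eq_true, List.any_eq_true, Bool.and_eq_true, beq_iff_eq] at h
      rcases h with (h | ⟨q, hq, hmul, hg⟩) | h
      · exact absurd hc (signTest_sound h hLO hM hlo hhi)
      · have h0 : evalL q x * evalL (polyQuot c q) x = 0 := by rw [← evalL_polyMul, hmul]; exact hc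
        rcases mul_eq_zero.mp h0 with hq0 | hg0
        · exact ⟨q, hq, hq0⟩
        · exact rootCovered_sound hLO hM hlo hhi fuel _ hg hg0
      · exact absurd hc (exclTest_sound c depth h hLO hM hlo hhi)

/-! ### The search over coefficient vectors -/

/-- Iterate `k` further coefficients over `[−H, H]`, appending them to `acc`, and require `f` on each
completed list. -/
def coeffLoop (H : ℤ) : ℕ → List ℤ → (List ℤ → Bool) → Bool
  | 0, acc, f => f acc
  | k + 1, acc, f => allIntIcc (-H) H fun a => coeffLoop H k (acc ++ [a]) f

/-- Soundness of `coeffLoop`: `f` holds on `acc ++ pre` for every `pre` of length `k` with entries in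
`[−H, H]`. -/
theorem coeffLoop_sound {H : ℤ} {f : List ℤ → Bool} : ∀ (k : ℕ) (acc : List ℤ),
    coeffLoop H k acc f = true → ∀ pre : List ℤ, pre.length = k → (∀ y ∈ pre, -H ≤ y ∧ y ≤ H) →
      f (acc ++ pre) = true
  | 0, acc, h, pre, hlen, _ => by
      rw [List.eq_nil_of_length_eq_zero hlen, List.append_nil]; simpa [coeffLoop] using h
  | k + 1, acc, h, pre, hlen, hb => by
      cases pre with
      | nil => simp at hlen
      | cons a pre' =>
        have ha := hb a (by simp)
        have h' : coeffLoop H k (acc ++ [a]) f = true :=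
          allIntIcc_sound (f := fun a => coeffLoop H k (acc ++ [a]) f) h ha.1 ha.2
        have := coeffLoop_sound k (acc ++ [a]) h' pre' (by simpa using hlen)
          (fun y hy => hb y (List.mem_cons_of_mem a hy))
        simpa using this

/-- The constant coefficients `a₀ ∈ [−H, H]` compatible with an enclosure `e = (U, V, N)` of
`x · (a₁ + a₂ x + ⋯)` are `−⌊V/N⌋ ≤ a₀ ≤ ⌊−U/N⌋`; require `f` on each. -/
def leafRange (H : ℤ) (f : ℤ → Bool) (e : ℤ × ℤ × ℤ) : Bool :=
  allIntIcc (max (-H) (-(e.2.1 / e.2.2))) (min H ((-e.1) / e.2.2)) f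

/-- Leaf of the search: `tail = [a₁, …, a_d]`; the constant coefficient is SOLVED (`leafRange` on the
enclosure of `x · (a₁ + a₂ x + ⋯)`) and each candidate `a₀ :: tail` must be `rootCovered`. -/
def leafCheck (H : ℤ) (depth fuel : ℕ) (ex : List (List ℤ)) (LO HI M : ℤ) (tail : List ℤ) : Bool :=
  leafRange H (fun a0 => rootCovered depth ex LO HI M fuel (a0 :: tail)) (encloseZ LO HI M (0 :: tail))

/-- Soundness of `leafCheck`: every root of a candidate `a₀ :: tail` with `a₀ ∈ [−H, H]` is covered. -/
theorem leafCheck_sound {H : ℤ} {depth fuel : ℕ} {ex : List (List ℤ)} {LO HI M : ℤ} (hLO : 0 ≤ LO)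
    (hM : 0 < M) {x : ℝ} (hlo : (LO : ℝ) ≤ x * M) (hhi : x * M ≤ HI) {tail : List ℤ}
    (h : leafCheck H depth fuel ex LO HI M tail = true) {a0 : ℤ} (ha0 : -H ≤ a0 ∧ a0 ≤ H)
    (hroot : evalL (a0 :: tail) x = 0) : ∃ q ∈ ex, evalL q x = 0 := by
  obtain ⟨h1, h2, hN⟩ := encloseZ_sound hLO hM hlo hhi (0 :: tail)
  set U := (encloseZ LO HI M (0 :: tail)).1 with hU
  set V := (encloseZ LO HI M (0 :: tail)).2.1 with hV
  set N := (encloseZ LO HI M (0 :: tail)).2.2 with hN'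
  have he : evalL (0 :: tail) x = -(a0 : ℝ) := by
    rw [evalL_cons] at hroot ⊢; push_cast; linarith
  rw [he] at h1 h2
  have i1 : U ≤ -a0 * N := by exact_mod_cast h1
  have i2 : -a0 * N ≤ V := by exact_mod_cast h2
  have hlo' : max (-H) (-(V / N)) ≤ a0 := by
    refine max_le ha0.1 ?_
    rw [neg_le, Int.le_ediv_iff_mul_le hN]; exact i2
  have hhi' : a0 ≤ min H ((-U) / N) := by
    refine le_min ha0.2 ?_
    rw [Int.le_ediv_iff_mul_le hN]; linarith
  unfold leafCheck leafRange at h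
  exact rootCovered_sound hLO hM hlo hhi fuel _ (allIntIcc_sound h hlo' hhi') hroot

/-- Integer core of the ALG checker on the interval `[LO/M, HI/M]`: leading coefficient `a_d ∈ [1, H]`,
middle coefficients by `coeffLoop`, constant coefficient and discharge by `leafCheck`. -/
def algCore (d : ℕ) (H : ℤ) (depth fuel : ℕ) (ex : List (List ℤ)) (LO HI M : ℤ) : Bool :=
  allIntIcc 1 H fun ad => coeffLoop H (d - 1) [] fun mid => leafCheck H depth fuel ex LO HI M (mid ++ [ad])

/-- Soundness of the integer core for a normalised coefficient list `a₀ :: (mid ++ [a_d])`,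
`1 ≤ a_d ≤ H`, all other coefficients in `[−H, H]`. -/
theorem algCore_sound {d : ℕ} {H : ℤ} {depth fuel : ℕ} {ex : List (List ℤ)} {LO HI M : ℤ}
    (h : algCore d H depth fuel ex LO HI M = true) (hLO : 0 ≤ LO) (hM : 0 < M) {x : ℝ}
    (hlo : (LO : ℝ) ≤ x * M) (hhi : x * M ≤ HI) {a0 ad : ℤ} {mid : List ℤ}
    (hlen : mid.length = d - 1) (had : 1 ≤ ad ∧ ad ≤ H) (hmid : ∀ y ∈ mid, -H ≤ y ∧ y ≤ H)
    (ha0 : -H ≤ a0 ∧ a0 ≤ H) (hroot : evalL (a0 :: (mid ++ [ad])) x = 0) :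
    ∃ q ∈ ex, evalL q x = 0 := by
  unfold algCore at h
  have h1 : coeffLoop H (d - 1) [] (fun mid => leafCheck H depth fuel ex LO HI M (mid ++ [ad])) = true :=
    allIntIcc_sound (f := fun ad => coeffLoop H (d - 1) [] fun mid =>
      leafCheck H depth fuel ex LO HI M (mid ++ [ad])) h had.1 had.2
  have h2 := coeffLoop_sound (d - 1) [] h1 mid hlen hmid
  simp only [List.nil_append] at h2
  exact leafCheck_sound hLO hM hlo hhi h2 ha0 hroot

end Summit.CriticalPhenomena.Ising3D
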